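import Summits.QuantumFields.YangMills.Theorems.Instrument.TorusCovering
import HarnessLib

/-!
# Instrument cell `ym-instrument`, crew (b): the LEVEL COUNT of RADIUS-DERIVATION v0.6.2 (7.0) (W1) and the key lemma of Lemma W — a free-link-connected, free-link-2-covered
# family of plaquettes of `ℤ⁴` on which the covering map to `(ℤ/L)⁴` is NOT injective has at least `2L` distinct images

QUESTIONS.md: Q-B2 (S2-SPEC v0.5.1 §0 reading (β-torus); RADIUS-DERIVATION (7.0) (W1)–(W2)); cell `run/shared/lean/pub/ym-instrument/`, HUMAN RULING D-0084 (2), director-ym R138.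
HONEST FRAMING (page 1, binding).  WHAT IS CERTIFIED HERE: PURE COMBINATORICS of `ℤ⁴` and its covering of `(ℤ/L)⁴` (`TorusCovering.πP`): (§1) levels: a link `(z, m)` of a plaquette
`q` has `q.1 μ ≤ z_μ ≤ q.1 μ + 1`, with `z_μ = q.1 μ` unless `q` SPANS `μ`; (§2) (W1): a `μ`-spanning plaquette owns a FREE `μ`-link (`PlaquetteLinkGeometry.not_isAxisLink_both`), so in
a family `C` in which every free link of a member lies in a second member, every `μ`-spanning member has a PARTNER in `C`, spanning `μ` at the same level and sharing a `μ`-link;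
(§3) along a free-link path inside `C` the base `μ`-coordinate moves by steps of size `≤ 1` and each increment `t → t+1` happens at a `μ`-spanning member of level `t`
(`exists_spanning_between`); (§4) ★ KEY LEMMA `exists_many_images`: if `p ≠ p'` in `C` are joined by a free-link path inside `C` and have the same image under `πP L` (`L ≥ 3`),
then some finite `S ⊆ C` has `2L` distinct images in `(ℤ/L)⁴` (levels `t, …, t+L−1` are distinct mod `L`; partners are distinguished by `TorusCovering.lift_unique`).  This is the
engine of both directions of Lemma W (census identity, next file); NOT the identity itself.  NOT a statement about any gauge theory; NOT summit-bearing.  Grade (T).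
-/

noncomputable section

open Finset
open Literature.MathematicalPhysics.QuantumLattice (ZdEdge ZdPlaquette plaquetteEdges torusEdge)
open Literature.MathematicalPhysics.QuantumFieldTheory (mk_mem_plaquetteEdges_iff)
open Literature.Probability.LatticeModels (Site Torus.proj Torus.proj_apply)
open Summit.QuantumFields.YangMills.Theorems.Instrument.FreeLinkPolymerDefs (IsAxisLink IsFreeLink)
open Summit.QuantumFields.YangMills.Theorems.Instrument.PlaquetteLinkGeometry (not_isAxisLink_both)
open Summit.QuantumFields.YangMills.Theorems.Instrument.TorusPolymerKraft (TSite TPlaquette)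
open Summit.QuantumFields.YangMills.Theorems.Instrument.TorusCovering (πS πP lift_unique)

namespace Summit.QuantumFields.YangMills.Theorems.Instrument.TorusLevelCount

variable {L : ℕ}

/-! ## §1 Levels -/

/-- The plaquette `q` SPANS the direction `μ` (one of its two directions is `μ`). [folklore] -/
abbrev Spans (μ : Fin 4) (q : ZdPlaquette 4) : Prop := q.2.1.1 = μ ∨ q.2.1.2 = μ

/-- **Corner bounds**: a link `(z, m)` of `q` has `q.1 μ ≤ z_μ ≤ q.1 μ + 1`, and `z_μ = q.1 μ` unless `q` spans `μ`. [folklore] -/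
theorem corner_bounds {q : ZdPlaquette 4} {z : Site 4} {m : Fin 4} (h : ((z, m) : ZdEdge 4) ∈ plaquetteEdges q) (μ : Fin 4) :
    q.1 μ ≤ z μ ∧ z μ ≤ q.1 μ + 1 ∧ (¬ Spans μ q → z μ = q.1 μ) := by
  obtain ⟨y, ⟨⟨a, b⟩, hab⟩⟩ := q
  rw [mk_mem_plaquetteEdges_iff] at h
  dsimp only at h ⊢
  have hsingle : ∀ c : Fin 4, (Pi.single c (1 : ℤ) : Site 4) μ = if c = μ then 1 else 0 := fun c => by
    by_cases hc : c = μ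
    · subst hc; simp
    · simp [hc]
  rcases h with ⟨-, rfl | rfl⟩ | ⟨-, rfl | rfl⟩
  · exact ⟨le_rfl, by omega, fun _ => rfl⟩
  · rw [Pi.add_apply, hsingle]
    refine ⟨by split_ifs <;> omega, by split_ifs <;> omega, fun hns => ?_⟩
    have hb : b ≠ μ := fun h => hns (Or.inr h)
    rw [if_neg hb, add_zero]
  · rw [Pi.add_apply, hsingle]
    refine ⟨by split_ifs <;> omega, by split_ifs <;> omega, fun hns => ?_⟩
    have ha : a ≠ μ := fun h => hns (Or.inl h)
    rw [if_neg ha, add_zero]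
  · exact ⟨le_rfl, by omega, fun _ => rfl⟩

/-- A link IN DIRECTION `μ` of `q` forces `q` to span `μ`, and sits at the base level: `z_μ = q.1 μ`. [folklore] -/
theorem spans_of_mem_dir {q : ZdPlaquette 4} {z : Site 4} {μ : Fin 4} (h : ((z, μ) : ZdEdge 4) ∈ plaquetteEdges q) : Spans μ q ∧ z μ = q.1 μ := by
  obtain ⟨y, ⟨⟨a, b⟩, hab⟩⟩ := q
  have hab' : a ≠ b := ne_of_lt hab
  rw [mk_mem_plaquetteEdges_iff] at h
  dsimp only at h ⊢
  rcases h with ⟨rfl, rfl | rfl⟩ | ⟨rfl, rfl | rfl⟩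
  · exact ⟨Or.inl rfl, rfl⟩
  · exact ⟨Or.inl rfl, by rw [Pi.add_apply, Pi.single_eq_of_ne hab', add_zero]⟩
  · exact ⟨Or.inr rfl, by rw [Pi.add_apply, Pi.single_eq_of_ne (Ne.symm hab'), add_zero]⟩
  · exact ⟨Or.inr rfl, rfl⟩

/-! ## §2 (W1): every spanning member has a partner at the same level -/

/-- A `μ`-spanning plaquette owns a FREE link in direction `μ` (its two `μ`-links are not both axis). [folklore] -/
theorem exists_free_dirLink {q : ZdPlaquette 4} {μ : Fin 4} (h : Spans μ q) : ∃ z : Site 4, ((z, μ) : ZdEdge 4) ∈ plaquetteEdges q ∧ IsFreeLink ((z, μ) : ZdEdge 4) := by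
  obtain ⟨y, ⟨⟨a, b⟩, hab⟩⟩ := q
  have hab' : a ≠ b := ne_of_lt hab
  rcases h with rfl | rfl
  · -- `μ = a`: links `(y, a)` and `(y + e_b, a)`
    by_cases hax : IsAxisLink ((y, a) : ZdEdge 4)
    · refine ⟨y + Pi.single b 1, ?_, fun h' => not_isAxisLink_both y hab' ⟨hax, h'⟩⟩
      rw [mk_mem_plaquetteEdges_iff]; exact Or.inl ⟨rfl, Or.inr rfl⟩
    · refine ⟨y, ?_, hax⟩
      rw [mk_mem_plaquetteEdges_iff]; exact Or.inl ⟨rfl, Or.inl rfl⟩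
  · -- `μ = b`: links `(y, b)` and `(y + e_a, b)`
    by_cases hax : IsAxisLink ((y, b) : ZdEdge 4)
    · refine ⟨y + Pi.single a 1, ?_, fun h' => not_isAxisLink_both y (Ne.symm hab') ⟨hax, h'⟩⟩
      rw [mk_mem_plaquetteEdges_iff]; exact Or.inr ⟨rfl, Or.inl rfl⟩
    · refine ⟨y, ?_, hax⟩
      rw [mk_mem_plaquetteEdges_iff]; exact Or.inr ⟨rfl, Or.inr rfl⟩

/-- «Every free link of a member of `C` lies in a second member of `C`» (free links `≥ 2`-covered inside the family `C`). [folklore] -/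
def TwoCovered (C : Set (ZdPlaquette 4)) : Prop :=
  ∀ q ∈ C, ∀ l ∈ plaquetteEdges q, IsFreeLink l → ∃ q' ∈ C, q' ≠ q ∧ l ∈ plaquetteEdges q'

/-- Free-link adjacency inside the family `C`. [folklore] -/
def FAdj (C : Set (ZdPlaquette 4)) (a b : ZdPlaquette 4) : Prop :=
  a ∈ C ∧ b ∈ C ∧ ∃ e : ZdEdge 4, IsFreeLink e ∧ e ∈ plaquetteEdges a ∧ e ∈ plaquetteEdges b

/-- `FAdj C` is symmetric. [folklore] -/
theorem fAdj_symm {C : Set (ZdPlaquette 4)} {a b : ZdPlaquette 4} (h : FAdj C a b) : FAdj C b a := by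
  obtain ⟨ha, hb, e, he, hea, heb⟩ := h
  exact ⟨hb, ha, e, he, heb, hea⟩

/-- Free-link paths reverse. [folklore] -/
theorem fAdj_path_symm {C : Set (ZdPlaquette 4)} {a b : ZdPlaquette 4} (h : Relation.ReflTransGen (FAdj C) a b) : Relation.ReflTransGen (FAdj C) b a := by
  induction h with
  | refl => exact Relation.ReflTransGen.refl
  | tail _ hcd ih => exact Relation.ReflTransGen.head (fAdj_symm hcd) ih

/-- ★ **(W1) PARTNER LEMMA**: in a free-2-covered family, every `μ`-spanning member `q` has a partner `q' ≠ q` in the family, spanning `μ` at the SAME level and sharing a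
`μ`-link with `q`. [folklore] -/
theorem exists_partner {C : Set (ZdPlaquette 4)} (h2 : TwoCovered C) {q : ZdPlaquette 4} (hq : q ∈ C) {μ : Fin 4} (hs : Spans μ q) :
    ∃ q' ∈ C, q' ≠ q ∧ Spans μ q' ∧ q'.1 μ = q.1 μ ∧ ∃ z : Site 4, ((z, μ) : ZdEdge 4) ∈ plaquetteEdges q ∧ ((z, μ) : ZdEdge 4) ∈ plaquetteEdges q' := by
  obtain ⟨z, hz, hfree⟩ := exists_free_dirLink hs
  obtain ⟨q', hq', hne, hz'⟩ := h2 q hq _ hz hfree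
  obtain ⟨hs', hl'⟩ := spans_of_mem_dir hz'
  obtain ⟨-, hl⟩ := spans_of_mem_dir hz
  exact ⟨q', hq', hne, hs', by rw [← hl', hl], z, hz, hz'⟩

/-! ## §3 Levels along a free-link path -/

/-- Adjacent plaquettes (a common link) have base `μ`-coordinates differing by at most one. [folklore] -/
theorem level_step {a b : ZdPlaquette 4} {e : ZdEdge 4} (hea : e ∈ plaquetteEdges a) (heb : e ∈ plaquetteEdges b) (μ : Fin 4) :
    b.1 μ ≤ a.1 μ + 1 ∧ a.1 μ ≤ b.1 μ + 1 := by
  obtain ⟨z, m⟩ := e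
  have ha := corner_bounds hea μ
  have hb := corner_bounds heb μ
  omega

/-- **Crossing lemma**: if adjacent `a`, `b` have `b.1 μ = a.1 μ + 1` then `a` spans `μ` (at level `a.1 μ`). [folklore] -/
theorem spans_of_step_up {a b : ZdPlaquette 4} {e : ZdEdge 4} (hea : e ∈ plaquetteEdges a) (heb : e ∈ plaquetteEdges b) {μ : Fin 4} (h : b.1 μ = a.1 μ + 1) :
    Spans μ a := by
  obtain ⟨z, m⟩ := e
  have ha := corner_bounds hea μ
  have hb := corner_bounds heb μ
  by_contra hns
  have := ha.2.2 hns
  omega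

/-- ★ **Levels are crossed at spanning members**: along a free-link path inside `C` from `p` to `p'`, every level `t` with `p.1 μ ≤ t < p'.1 μ` is the level of a `μ`-spanning member
of `C`. [folklore] -/
theorem exists_spanning_between {C : Set (ZdPlaquette 4)} {p p' : ZdPlaquette 4} (hpath : Relation.ReflTransGen (FAdj C) p p') (μ : Fin 4) :
    ∀ t : ℤ, p.1 μ ≤ t → t < p'.1 μ → ∃ q ∈ C, Spans μ q ∧ q.1 μ = t := by
  induction hpath with
  | refl => intro t h1 h2; omega
  | @tail b c _ hbc ih =>
    intro t h1 h2
    obtain ⟨hb, _, e, -, heb, hec⟩ := hbc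
    by_cases hlt : t < b.1 μ
    · exact ih t h1 hlt
    · -- `b.1 μ ≤ t < c.1 μ ≤ b.1 μ + 1`
      have hstep := level_step heb hec μ
      have ht : t = b.1 μ := by omega
      have hc1 : c.1 μ = b.1 μ + 1 := by omega
      exact ⟨b, hb, spans_of_step_up heb hec hc1, ht.symm⟩

/-! ## §4 ★ The key lemma: a non-injective image has at least `2L` elements -/

/-- Equal site projections: every coordinate difference is a multiple of `L`. [folklore] -/
theorem dvd_sub_of_πS_eq [NeZero L] {x x' : Site 4} (h : πS L x = πS L x') (μ : Fin 4) : (L : ℤ) ∣ x' μ - x μ := by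
  have := congrFun h μ
  rw [show πS L x μ = ((x μ : ℤ) : ZMod L) from Torus.proj_apply L x μ, show πS L x' μ = ((x' μ : ℤ) : ZMod L) from Torus.proj_apply L x' μ] at this
  exact (ZMod.intCast_eq_intCast_iff_dvd_sub _ _ _).1 this

/-- The `μ`-coordinate of the image determines the level mod `L`: spanning members at levels `t₀ + k`, `t₀ + k'` (`k, k' < L`) with the same image have `k = k'`. [folklore] -/
theorem eq_of_level_window [NeZero L] {q q' : ZdPlaquette 4} (h : πP L q = πP L q') {μ : Fin 4} {t₀ : ℤ} {k k' : ℕ} (hk : k < L) (hk' : k' < L)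
    (hq : q.1 μ = t₀ + k) (hq' : q'.1 μ = t₀ + k') : k = k' := by
  have hπ1 : πS L q.1 = πS L q'.1 := (Prod.mk.inj (show (πS L q.1, q.2) = (πS L q'.1, q'.2) from h)).1
  have hd := dvd_sub_of_πS_eq hπ1 μ
  rw [hq, hq'] at hd
  have : (L : ℤ) ∣ (k' : ℤ) - (k : ℤ) := by convert hd using 1; ring
  rcases le_or_gt (k : ℤ) k' with hle | hlt
  · have := Int.eq_zero_of_dvd_of_nonneg_of_lt (by omega) (by omega) this
    omega
  · have h' : (L : ℤ) ∣ (k : ℤ) - (k' : ℤ) := by rw [← neg_sub]; exact this.neg_right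
    have := Int.eq_zero_of_dvd_of_nonneg_of_lt (by omega) (by omega) h'
    omega

/-- ★ LEVEL COUNT ⟹ MANY IMAGES: if `L` consecutive `μ`-levels `t₀, …, t₀ + L − 1` each carry a `μ`-spanning member of a free-2-covered family `C` (`L ≥ 3`), then `C` has `2L`
members with pairwise distinct torus images (the spanning members and their (W1) partners; levels are distinct mod `L`, partners are separated by `lift_unique`). [folklore] -/
theorem many_images_of_levels [NeZero L] (hL : 3 ≤ L) {C : Set (ZdPlaquette 4)} (h2 : TwoCovered C) (μ : Fin 4) (t₀ : ℤ)
    (hsp : ∀ k : Fin L, ∃ q ∈ C, Spans μ q ∧ q.1 μ = t₀ + k) :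
    ∃ S : Finset (ZdPlaquette 4), (↑S : Set (ZdPlaquette 4)) ⊆ C ∧ 2 * L ≤ (S.image (πP L)).card := by
  classical
  choose q hqC hqs hql using hsp
  have hpt : ∀ k : Fin L, ∃ q' ∈ C, q' ≠ q k ∧ Spans μ q' ∧ q'.1 μ = (q k).1 μ ∧
      ∃ z : Site 4, ((z, μ) : ZdEdge 4) ∈ plaquetteEdges (q k) ∧ ((z, μ) : ZdEdge 4) ∈ plaquetteEdges q' := fun k => exists_partner h2 (hqC k) (hqs k)
  choose q' hq'C hq'ne _ hq'l hz using hpt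
  -- the `2L` plaquettes and the injectivity of their images
  let g : Fin L × Bool → ZdPlaquette 4 := fun kb => if kb.2 then q kb.1 else q' kb.1
  have hgC : ∀ kb, g kb ∈ C := fun kb => by
    simp only [g]; split_ifs
    · exact hqC _
    · exact hq'C _
  have hinj : Function.Injective (πP L ∘ g) := by
    intro ⟨k, b⟩ ⟨k', b'⟩ heq
    simp only [Function.comp, g] at heq
    have hlev : ∀ (k : Fin L) (b : Bool), (if b then q k else q' k).1 μ = t₀ + (k : ℕ) := fun k b => by
      cases b
      · simp only [Bool.false_eq_true, if_false]; rw [hq'l, hql]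
      · simp only [if_true]; rw [hql]
    have hkk : (k : ℕ) = k' := eq_of_level_window heq k.2 k'.2 (hlev k b) (hlev k' b')
    have hk : k = k' := Fin.ext hkk
    subst hk
    cases b <;> cases b'
    · rfl
    · exfalso
      simp only [Bool.false_eq_true, if_false, if_true] at heq
      obtain ⟨z, hzq, hzq'⟩ := hz k
      exact hq'ne k (lift_unique hL hzq' hzq heq)
    · exfalso
      simp only [Bool.false_eq_true, if_false, if_true] at heq
      obtain ⟨z, hzq, hzq'⟩ := hz k
      exact hq'ne k (lift_unique hL hzq' hzq heq.symm)
    · rfl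
  refine ⟨Finset.univ.image g, fun x hx => ?_, ?_⟩
  · obtain ⟨kb, -, rfl⟩ := mem_image.1 (mem_coe.1 hx)
    exact hgC kb
  · rw [image_image, card_image_of_injective _ hinj, card_univ, Fintype.card_prod, Fintype.card_fin, Fintype.card_bool]
    omega

/-- A nonzero integer multiple of `L` is `≥ L` or `≤ −L`. [folklore] -/
theorem far_of_dvd_of_ne {L : ℕ} {x y : ℤ} (hdvd : (L : ℤ) ∣ y - x) (hne : x ≠ y) : x + L ≤ y ∨ y + L ≤ x := by
  obtain ⟨c, hc⟩ := hdvd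
  rcases lt_trichotomy c 0 with h | h | h
  · right; nlinarith
  · exfalso; subst h; simp only [mul_zero, sub_eq_zero] at hc; exact hne hc.symm
  · left; nlinarith

/-- ★ **KEY LEMMA (engine of Lemma W).**  `L ≥ 3`.  If `C` is free-2-covered, `p ≠ p'` lie in `C`, are joined by a free-link path inside `C`, and have the same image under
`πP L`, then there is a finite `S ⊆ C` whose image in the torus has `2L` distinct elements. [folklore] -/
theorem exists_many_images [NeZero L] (hL : 3 ≤ L) {C : Set (ZdPlaquette 4)} (h2 : TwoCovered C) {p p' : ZdPlaquette 4}
    (hpath : Relation.ReflTransGen (FAdj C) p p') (hne : p ≠ p') (hπ : πP L p = πP L p') :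
    ∃ S : Finset (ZdPlaquette 4), (↑S : Set (ZdPlaquette 4)) ⊆ C ∧ 2 * L ≤ (S.image (πP L)).card := by
  classical
  -- the base points differ by a nonzero vector with all coordinates divisible by `L`
  have hπ' := Prod.mk.inj (show (πS L p.1, p.2) = (πS L p'.1, p'.2) from hπ)
  have hbase : p.1 ≠ p'.1 := fun h => hne (Prod.ext h hπ'.2)
  obtain ⟨μ, hμ⟩ : ∃ μ, p.1 μ ≠ p'.1 μ := Function.ne_iff.1 hbase
  -- along the path, the `L` levels above the lower endpoint carry spanning members
  have key : ∀ {a a' : ZdPlaquette 4}, Relation.ReflTransGen (FAdj C) a a' → a.1 μ + L ≤ a'.1 μ →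
      ∃ S : Finset (ZdPlaquette 4), (↑S : Set (ZdPlaquette 4)) ⊆ C ∧ 2 * L ≤ (S.image (πP L)).card := by
    intro a a' hpath hfar
    exact many_images_of_levels hL h2 μ (a.1 μ) fun k => exists_spanning_between hpath μ (a.1 μ + k) (by omega) (by omega)
  rcases far_of_dvd_of_ne (dvd_sub_of_πS_eq hπ'.1 μ) hμ with hfar | hfar
  · exact key hpath hfar
  · exact key (fAdj_path_symm hpath) hfar

/-- ★ (W1′) LINK VERSION (RADIUS-DERIVATION v0.6.3 (7.0) (W1′)): two DISTINCT links of members `p, p'` of a free-2-covered family `C`, joined by a free-link path inside `C`, with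
the same torus image force `2L` members of `C` with pairwise distinct torus images (`L ≥ 3`).  The `L` levels: those met by the path, plus — in the extreme case — the level of the
far endpoint itself, which then spans `μ` because its far link sits at offset `e_μ`. [folklore] -/
theorem exists_many_images_of_links [NeZero L] (hL : 3 ≤ L) {C : Set (ZdPlaquette 4)} (h2 : TwoCovered C) {p p' : ZdPlaquette 4} (hp : p ∈ C) (hp' : p' ∈ C)
    (hpath : Relation.ReflTransGen (FAdj C) p p') {l l' : ZdEdge 4} (hl : l ∈ plaquetteEdges p) (hl' : l' ∈ plaquetteEdges p') (hne : l ≠ l')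
    (hπ : torusEdge L l = torusEdge L l') :
    ∃ S : Finset (ZdPlaquette 4), (↑S : Set (ZdPlaquette 4)) ⊆ C ∧ 2 * L ≤ (S.image (πP L)).card := by
  classical
  obtain ⟨z, i⟩ := l
  obtain ⟨z', i'⟩ := l'
  have hπ' := Prod.mk.inj (show (πS L z, i) = (πS L z', i') from hπ)
  have hbase : z ≠ z' := fun h => hne (Prod.ext h hπ'.2)
  obtain ⟨μ, hμ⟩ : ∃ μ, z μ ≠ z' μ := Function.ne_iff.1 hbase
  -- general step, for a path `a → a'` with links `(w, j) ∈ a`, `(w', j') ∈ a'`, `w μ + L ≤ w' μ`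
  have key : ∀ {a a' : ZdPlaquette 4} {w w' : Site 4} {j j' : Fin 4}, a' ∈ C → Relation.ReflTransGen (FAdj C) a a' →
      ((w, j) : ZdEdge 4) ∈ plaquetteEdges a → ((w', j') : ZdEdge 4) ∈ plaquetteEdges a' → w μ + L ≤ w' μ →
      ∃ S : Finset (ZdPlaquette 4), (↑S : Set (ZdPlaquette 4)) ⊆ C ∧ 2 * L ≤ (S.image (πP L)).card := by
    intro a a' w w' j j' ha' hpath hw hw' hfar
    obtain ⟨ha1, -, -⟩ := corner_bounds hw μ
    obtain ⟨-, hb2, hb3⟩ := corner_bounds hw' μ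
    refine many_images_of_levels hL h2 μ (w μ) fun k => ?_
    by_cases hk : w μ + k < a'.1 μ
    · exact exists_spanning_between hpath μ _ (by omega) hk
    · -- extreme case: `k = L − 1`, the far link sits at offset `e_μ` in `a'`, so `a'` spans `μ` at the last level
      have hkL : (k : ℤ) < L := by exact_mod_cast k.2
      have ht : a'.1 μ = w μ + k := by omega
      have hsp : Spans μ a' := by
        by_contra hns
        have := hb3 hns
        omega
      exact ⟨a', ha', hsp, ht⟩
  rcases far_of_dvd_of_ne (dvd_sub_of_πS_eq hπ'.1 μ) hμ with hfar | hfar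
  · exact key hp' hpath hl hl' hfar
  · exact key hp (fAdj_path_symm hpath) hl' hl hfar

end Summit.QuantumFields.YangMills.Theorems.Instrument.TorusLevelCount

end
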